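/-
Copyright: statement-level skeleton of a published paper (lit-balaban cell, Phase-2 proof seat p39 gen 15). No proof claims
beyond what the kernel checks below.
-/
import Literature.MathematicalPhysics.QuantumFieldTheory.Balaban1983to89.B3WT226PeriodicLimit

/-!
# B3 — T. Bałaban, *(Higgs)₂,₃ quantum fields in a finite volume. III. Renormalization*, CMP **88** (1983) 411–445
[Balaban1983Higgs3], (2.26) p. 431 [PDF 21]: **THE KERNEL WARD–TAKAHASHI IDENTITY ON THE INFINITE LATTICE `ηℤ^d`** — the
propagator-level mechanism behind the Ward–Takahashi identities at free boundary conditions: for EVERY kernel `C` solving the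
lattice equation `(−Δ^η + M²)C = η^{−d}δ` on `ℤ^d` and every finitely supported gauge function `λ`, the current `∂^ηλ` inserted
between two propagators telescopes to the gauge variation of a single propagator between its endpoints,
`Σ_{b′}(∂^ηλ)(b′)[C(u − b′₋)C(b′₊ − v) − C(u − b′₊)C(b′₋ − v)] = η^{1−d}·C(u − v)·(λ(v) − λ(u))` (`u, v ∈ ℤ^d`), and, as its first
corollary, the per-bond right member of (2.26) at free boundary conditions (`−wt1 + wt2 − wt3 − wt4 = 0` of `B3WT226FreeLattice`)
for every finitely supported `λ` — a second proof, by the kernel identity, of what this seat's gen 11/12 proved by summation by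
parts / by the print's periodic limit (`B3WT226FreeLattice.bracket226_eq_zero`, `B3WT226PeriodicLimit.bracket226_eq_zero_of_periodic_limit`)

statement-level skeleton of published theorems with citation tags; proofs where landed; nothing here is a claim about
the Yang–Mills mass gap

PDF held: `paper:balaban1983-higgs-2-3-quantum-fields-finite-volume` (journal page = PDF page + 410); p. 431 [PDF 21] re-read for this
file (text layer `p0021.txt` L2–22: (2.25), (2.26), (2.27), (2.28) and the two sentences quoted below).

CITATION HEADER (lean-in-tree rule).  Part of the lit-balaban TYPED SKELETON (HOME `run/shared/lean/pub/lit-balaban/`), PHASE 2,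
proof seat p39 (generation 15).  Row **B3.Eq2.26-2.28** of `HOME/lit-balaban-r15/ROWS-B3.md` (fold owner r15).  The owner's head
question of 2026-08-22T17:43Z names as residual prose *"Taking other functions F, or differentiating (2.24) to higher order in A, we
can get all necessary Ward-Takahashi identities. They hold for free boundary conditions also by taking a limit of the identities with
periodic boundary conditions."*  On `ηℤ^d` the tree has (2.25)/(2.26) (gen 11/12: `B3WT226FreeLattice`, `B3WT226PeriodicLimit`,
`B3WT226FreeGaussian`, `B3WTPeriodicMeasure`) and (2.28) (gen 15: `B3FreeWickVertexCalculus`, `B3WT228FreeGaussian`); the identities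
for *"other functions F"* — `F = :|φ(z)|²:`, drawn on the model torus in `B3WT228Phi2Graphs` — do NOT vanish picture by picture:
their pictures sum to zero by a kernel identity which, for the torus, is the trace algebra of `B3WT228Phi2Graphs` and which was not
in the tree for `ηℤ^d`.  THIS FILE supplies that kernel identity on `ηℤ^d` in its fundamental (two-point, "opened") form
`current_insertion_eq`; the Gaussian `:|φ(z)|²:` identities at free boundary conditions are assembled from it in the sequel file.
Tree vocabulary used BY NAME: `ZSite`, `unitVec`, `pdiffZ`, `negLapZ` (`B3Sect3VectorSelfEnergy`), `hop`, `negLapZ_eq_hop`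
(`B3CxiPropagator`), `kerCDZ`, `kerDCDZ`, `wt3`, `wt4`, `bracket226`, `CetaM`, `CetaM_neg`, `negLapZ_CetaM_add` (`B3WT226FreeLattice`),
`wt1Fin`, `wt2Fin`, `bracketFin`, `dSupp`, `bracket226_eq_bracketFin` (`B3WT226PeriodicLimit`).

THE PRINTED TEXT (verbatim, p. 431 [PDF 21]).  L4–9: *"Taking F = 1, differentiating with respect to A and next taking A = 0 and
using the identity (2.25), we get* [(2.26): `e_k⟨∂^ηφ, Aqφ⟩(:⟨∂^ηφ, ∂^ηλqφ⟩:)`-pairings written with the kernels `(∂^ηC^η_{M²}∂^{η*})(b, b′)`,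
`(C^η_{M²}∂^{η*})`, `(∂^ηC^η_{M²})`, `− e_kΣ_bη^dA_b(∂^ηλ)(b) tr q²(C^η_{M²}∂^{η*})(b₋, b) = 0`] *"*;  L20–22: *"Taking other functions F,
or differentiating (2.24) to higher order in A, we can get all necessary Ward-Takahashi identities. They hold for free boundary
conditions also by taking a limit of the identities with periodic boundary conditions."*

WHAT IS PROVED (theorems only, no measure theory: `d : ℕ`, `η M2 : ℝ`, `Cf : ℤ^d → ℝ`; the lattice equation is the tree's
`negLapZ η Cf z + M2 * Cf z = if z = 0 then η⁻¹ ^ d else 0` of `B3WT226FreeLattice.negLapZ_CetaM_add`; test functions `lam : ℤ^d → ℝ`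
vanishing off a finite `T`, `b′`-sums over any finite window `S ⊇ T ∪ ⋃_ν(T − e_ν)`; `c = η⁻¹` as in `B3WT226FreeLattice`).
* §1 `hop_eq_of_ne` (`Σ_ν[C(z + e_ν) + C(z − e_ν)] = 2dC(z) − η²(−Δ^ηC)(z)`), `sum_shift_of_support`, `sum_restrict_of_support`
  (summation by parts against a finitely supported `λ`), and **`current_insertion_eq`** — THE KERNEL IDENTITY: for `η ≠ 0` and every
  solution `C` of the lattice equation, `Σ_{x′∈S}Σ_ν(∂^ηλ)(x′,ν)·[C(u − x′)C(x′ + e_ν − v) − C(u − x′ − e_ν)C(x′ − v)] =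
  η·η^{−d}·C(u − v)·(λ(v) − λ(u))` for ALL `u, v` (in operator language `G[Λ, −Δ^η + M²]G = [G, Λ]`-type telescoping, `G = C(· − ·)`,
  `Λ =` multiplication by `λ`: summation by parts moves the difference onto the two propagators, the `ν`-sum of second differences is
  `(HC)(u − w)C(w − v) − C(u − w)(HC)(w − v)`, and the lattice equation at `w` leaves the two `δ`'s).
* §2 `neg_wt1Fin_add_wt2Fin_eq` (the two `b′`-summed terms of (2.26) at `b = (x, μ)` are `η^dc²·[Φ(x, b₊) − Φ(x, b₋)]`, `Φ(u,v)` the left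
  member of §1), **`bracketFin_eq_zero`** (for `η ≠ 0`, `C` even solving the lattice equation, `λ` supported in a finite `S`:
  `bracketFin (dSupp S) η C λ x μ = 0` at every bond), **`bracket226_eq_zero_of_current_insertion`** (hence the free bracket with infinite
  `b′`-sums `bracket226 η C λ x μ = 0`) and the instance `bracket226_CetaM_eq_zero` (`C = C^η_{M²}`, `η > 0`, `M² > 0`).
HONEST SCOPE: (i) kernel level only — no Gaussian integral is taken here; the Gaussian forms of (2.26) on `ηℤ^d` are gen 12's
`B3WT226FreeGaussian` (whose scalar input `bracket226 = 0` this file re-proves under the weaker hypotheses "finitely supported `λ`,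
any `η ≠ 0`, no summability of `C`"), and the `F = :|φ(z)|²:` identities built on `current_insertion_eq` are the sequel file's;
(ii) the print does not display the two-point identity `current_insertion_eq` — it displays its consequences (2.25)–(2.28) and
asserts the rest by L20–22; the identity is the standard resolvent commutator computation and is tagged to (2.26), the display it
proves; (iii) finitely supported `λ` only (the print's gauge functions live on a finite torus / are compactly supported; gen 11's
`bracket226_eq_zero` covers polynomially bounded `λ` against summably decaying `C`); (iv) "differentiating (2.24) to higher order
in A" is not addressed.  Mathlib + the cited tree files only; theorems, no definition, no named fact, no `sorry`; standard axioms.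
Unit `lit-balaban-p39-g15` (Phase-2 proof seat p39, gen 15), HOME `run/shared/lean/pub/lit-balaban/`, 2026-08-22.

References: [Balaban1983Higgs3] T. Bałaban, CMP 88 (1983) 411–445, (2.23) p. 430, (2.25)–(2.28) p. 431.
-/

noncomputable section

open scoped BigOperators
open Finset

namespace Literature.MathematicalPhysics.QuantumFieldTheory.Balaban1983to89.B3WTKernelWardIdentity

open B3Sect3VectorSelfEnergy B3CxiPropagator B3WT226FreeLattice B3WT226PeriodicLimit
open Literature.MathematicalPhysics.QuantumFieldTheory

variable {d : ℕ} {η M2 : ℝ} {Cf : ZSite d → ℝ}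

/-! ## §1 The current insertion telescopes -/

/-- the nearest-neighbour sum in terms of the lattice equation: `(HC)(z) = 2dC(z) − η²(−Δ^ηC)(z)`. [cite: Balaban1983Higgs3, (2.23) p.430] -/
theorem hop_eq_of_ne (hη : η ≠ 0) (f : ZSite d → ℝ) (z : ZSite d) : hop f z = 2 * d * f z - η ^ 2 * negLapZ η f z := by
  rw [negLapZ_eq_hop]
  field_simp
  ring

/-- shifting a sum against a test function supported in `T`: `Σ_{x′∈S}λ(x′ + e_ν)g(x′) = Σ_{w∈T}λ(w)g(w − e_ν)` when `S ⊇ T − e_ν`.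
[cite: Balaban1983Higgs3, (2.26) p.431] -/
theorem sum_shift_of_support {T S : Finset (ZSite d)} {lam : ZSite d → ℝ} (hT : ∀ x, x ∉ T → lam x = 0)
    (hTS' : ∀ ν : Fin d, ∀ x ∈ T, x - unitVec ν ∈ S) (ν : Fin d) (g : ZSite d → ℝ) :
    ∑ x' ∈ S, lam (x' + unitVec ν) * g x' = ∑ w ∈ T, lam w * g (w - unitVec ν) := by
  classical
  have hinj : Set.InjOn (fun w : ZSite d => w - unitVec ν) (T : Set (ZSite d)) := fun a _ b _ h => sub_left_injective h
  have hIS : T.image (fun w => w - unitVec ν) ⊆ S := by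
    intro x hx
    obtain ⟨w, hw, rfl⟩ := Finset.mem_image.mp hx
    exact hTS' ν w hw
  rw [← Finset.sum_subset hIS (fun x _ hxI => ?_), Finset.sum_image hinj]
  · exact Finset.sum_congr rfl fun w _ => by rw [sub_add_cancel]
  · have hx : x + unitVec ν ∉ T := fun h => hxI (Finset.mem_image.mpr ⟨x + unitVec ν, h, by rw [add_sub_cancel_right]⟩)
    rw [hT _ hx, zero_mul]

/-- restricting a sum against a test function supported in `T ⊆ S` to `T`. [cite: Balaban1983Higgs3, (2.26) p.431] -/
theorem sum_restrict_of_support {T S : Finset (ZSite d)} {lam : ZSite d → ℝ} (hT : ∀ x, x ∉ T → lam x = 0) (hTS : T ⊆ S)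
    (g : ZSite d → ℝ) : ∑ x' ∈ S, lam x' * g x' = ∑ w ∈ T, lam w * g w :=
  (Finset.sum_subset hTS fun x _ hxT => by rw [hT x hxT, zero_mul]).symm

/-- **THE KERNEL WARD–TAKAHASHI IDENTITY ON `ηℤ^d`** — the mechanism behind (2.25)/(2.26) (and behind the identities with the
functions `F` of p. 430 inserted) at the level of propagators: for EVERY kernel `C` solving the lattice equation
`(−Δ^η + M²)C = η^{−d}δ` and every finitely supported gauge function `λ` (support `T`, window `S ⊇ T ∪ ⋃_ν(T − e_ν)`), the current
`∂^ηλ` inserted between two propagators telescopes to the gauge variation of one propagator between its endpoints: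
`Σ_{b′}(∂^ηλ)(b′)[C(u − b′₋)C(b′₊ − v) − C(u − b′₊)C(b′₋ − v)] = η^{1−d}·C(u − v)·(λ(v) − λ(u))` for all sites `u, v` (summation by parts
and the lattice equation in either variable: `G[λ,−Δ^η+M²]G = Gλ − λG` for `G = (−Δ^η+M²)^{−1}`). [cite: Balaban1983Higgs3, (2.26) p.431] -/
theorem current_insertion_eq (hη : η ≠ 0) (hCeq : ∀ z, negLapZ η Cf z + M2 * Cf z = if z = 0 then η⁻¹ ^ d else 0)
    {T S : Finset (ZSite d)} {lam : ZSite d → ℝ} (hT : ∀ x, x ∉ T → lam x = 0) (hTS : T ⊆ S)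
    (hTS' : ∀ ν : Fin d, ∀ x ∈ T, x - unitVec ν ∈ S) (u v : ZSite d) :
    ∑ x' ∈ S, ∑ ν : Fin d, pdiffZ η⁻¹ ν lam x' *
        (Cf (u - x') * Cf (x' + unitVec ν - v) - Cf (u - (x' + unitVec ν)) * Cf (x' - v)) =
      η * η⁻¹ ^ d * (Cf (u - v) * (lam v - lam u)) := by
  classical
  -- the summand `X(x′, ν)`
  obtain ⟨X, hX⟩ : ∃ X : ZSite d → Fin d → ℝ, ∀ x' ν,
      Cf (u - x') * Cf (x' + unitVec ν - v) - Cf (u - (x' + unitVec ν)) * Cf (x' - v) = X x' ν := ⟨_, fun _ _ => rfl⟩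
  simp only [hX]
  -- summation by parts against the finitely supported `λ`
  have step1 : ∑ x' ∈ S, ∑ ν : Fin d, pdiffZ η⁻¹ ν lam x' * X x' ν =
      ∑ ν : Fin d, η⁻¹ * ∑ w ∈ T, lam w * (X (w - unitVec ν) ν - X w ν) := by
    rw [Finset.sum_comm]
    refine Finset.sum_congr rfl fun ν _ => ?_
    have hsplit : ∀ x', pdiffZ η⁻¹ ν lam x' * X x' ν =
        η⁻¹ * (lam (x' + unitVec ν) * X x' ν) - η⁻¹ * (lam x' * X x' ν) := by
      intro x'; simp only [pdiffZ]; ring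
    simp only [hsplit, Finset.sum_sub_distrib, ← Finset.mul_sum]
    rw [sum_shift_of_support hT hTS' ν, sum_restrict_of_support hT hTS, ← mul_sub, ← Finset.sum_sub_distrib]
    congr 1
    exact Finset.sum_congr rfl fun w _ => by ring
  rw [step1, ← Finset.mul_sum, Finset.sum_comm]
  simp only [← Finset.mul_sum]
  -- the `ν`-sum at a site `w ∈ T`: nearest-neighbour sums, then the lattice equation
  have hdelta : ∀ z, η ^ 2 * negLapZ η Cf z = (if z = 0 then η ^ 2 * η⁻¹ ^ d else 0) - η ^ 2 * M2 * Cf z := by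
    intro z
    have h := hCeq z
    split_ifs at h ⊢ with hz
    · linear_combination η ^ 2 * h
    · linear_combination η ^ 2 * h
  have hw : ∀ w : ZSite d, ∑ ν : Fin d, (X (w - unitVec ν) ν - X w ν) =
      -(if u - w = 0 then η ^ 2 * η⁻¹ ^ d else 0) * Cf (w - v) + Cf (u - w) * (if w - v = 0 then η ^ 2 * η⁻¹ ^ d else 0) := by
    intro w
    have e1 : ∑ ν : Fin d, (X (w - unitVec ν) ν - X w ν) = hop Cf (u - w) * Cf (w - v) - Cf (u - w) * hop Cf (w - v) := by
      simp only [← hX, hop, Finset.sum_mul, Finset.mul_sum, ← Finset.sum_sub_distrib]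
      refine Finset.sum_congr rfl fun ν _ => ?_
      have a1 : u - (w - unitVec ν) = u - w + unitVec ν := by abel
      have a2 : w - unitVec ν + unitVec ν - v = w - v := by abel
      have a3 : u - (w - unitVec ν + unitVec ν) = u - w := by abel
      have a4 : w - unitVec ν - v = w - v - unitVec ν := by abel
      have a5 : w + unitVec ν - v = w - v + unitVec ν := by abel
      have a6 : u - (w + unitVec ν) = u - w - unitVec ν := by abel
      rw [a1, a2, a3, a4, a5, a6]
      ring
    rw [e1, hop_eq_of_ne hη, hop_eq_of_ne hη, hdelta, hdelta]
    ring
  simp_rw [hw]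
  have hA : ∑ w ∈ T, lam w * (-(if u - w = 0 then η ^ 2 * η⁻¹ ^ d else 0) * Cf (w - v)) =
      if u ∈ T then -(lam u * (η ^ 2 * η⁻¹ ^ d) * Cf (u - v)) else 0 := by
    rw [← Finset.sum_ite_eq T u (fun w => -(lam w * (η ^ 2 * η⁻¹ ^ d) * Cf (w - v)))]
    refine Finset.sum_congr rfl fun w _ => ?_
    by_cases h : u = w
    · subst h; simp only [sub_self, if_true]; ring
    · rw [if_neg (fun h' => h (sub_eq_zero.mp h')), if_neg h]; ring
  have hB : ∑ w ∈ T, lam w * (Cf (u - w) * (if w - v = 0 then η ^ 2 * η⁻¹ ^ d else 0)) =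
      if v ∈ T then lam v * (Cf (u - v) * (η ^ 2 * η⁻¹ ^ d)) else 0 := by
    rw [← Finset.sum_ite_eq' T v (fun w => lam w * (Cf (u - w) * (η ^ 2 * η⁻¹ ^ d)))]
    refine Finset.sum_congr rfl fun w _ => ?_
    by_cases h : w = v
    · subst h; simp only [sub_self, if_true]
    · rw [if_neg (fun h' => h (sub_eq_zero.mp h')), if_neg h]; ring
  simp only [mul_add, Finset.sum_add_distrib]
  rw [hA, hB]
  have hu : (if u ∈ T then -(lam u * (η ^ 2 * η⁻¹ ^ d) * Cf (u - v)) else 0) = -(lam u * (η ^ 2 * η⁻¹ ^ d) * Cf (u - v)) := by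
    by_cases h : u ∈ T
    · rw [if_pos h]
    · rw [if_neg h, hT u h]; ring
  have hv : (if v ∈ T then lam v * (Cf (u - v) * (η ^ 2 * η⁻¹ ^ d)) else 0) = lam v * (Cf (u - v) * (η ^ 2 * η⁻¹ ^ d)) := by
    by_cases h : v ∈ T
    · rw [if_pos h]
    · rw [if_neg h, hT v h]; ring
  rw [hu, hv]
  field_simp
  ring

/-! ## §2 (2.26) per bond at free boundary conditions, from the kernel identity -/

/-- the two `b′`-summed terms of (2.26) at the bond `b = (x, μ)` ARE a difference of two current insertions: per summand,
`−(∂C∂^*)(b,b′)(∂C∂^*)… + …` — precisely `η^dc²·[X_{x,b₊}(b′) − X_{x,b₋}(b′)]` with `X_{u,v}(b′) = C(u − b′₋)C(b′₊ − v) − C(u − b′₊)C(b′₋ − v)`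
the summand of `current_insertion_eq`. [cite: Balaban1983Higgs3, (2.26) p.431] -/
theorem neg_wt1Fin_add_wt2Fin_eq (S' : Finset (ZSite d)) (lam : ZSite d → ℝ) (x : ZSite d) (μ : Fin d) :
    -wt1Fin S' η Cf lam x μ + wt2Fin S' η Cf lam x μ =
      η ^ d * η⁻¹ ^ 2 *
        ((∑ x' ∈ S', ∑ ν : Fin d, pdiffZ η⁻¹ ν lam x' *
            (Cf (x - x') * Cf (x' + unitVec ν - (x + unitVec μ)) - Cf (x - (x' + unitVec ν)) * Cf (x' - (x + unitVec μ)))) -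
          ∑ x' ∈ S', ∑ ν : Fin d, pdiffZ η⁻¹ ν lam x' *
            (Cf (x - x') * Cf (x' + unitVec ν - x) - Cf (x - (x' + unitVec ν)) * Cf (x' - x))) := by
  rw [mul_sub, Finset.mul_sum, Finset.mul_sum, ← Finset.sum_sub_distrib, wt1Fin, wt2Fin, ← Finset.sum_neg_distrib,
    ← Finset.sum_add_distrib]
  refine Finset.sum_congr rfl fun x' _ => ?_
  rw [Finset.mul_sum, Finset.mul_sum, Finset.mul_sum, Finset.mul_sum, ← Finset.sum_sub_distrib, ← Finset.sum_neg_distrib,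
    ← Finset.sum_add_distrib]
  refine Finset.sum_congr rfl fun ν _ => ?_
  simp only [kerCDZ, kerDCDZ]
  ring

variable {S : Finset (ZSite d)} {lam : ZSite d → ℝ}

/-- **(2.26) per bond from the kernel Ward identity** — a second, independent proof of the free-lattice bracket of
`B3WT226FreeLattice`/`B3WT226PeriodicLimit` for FINITELY SUPPORTED test functions, with no summability hypothesis on the kernel:
for every `η ≠ 0`, every even `C` solving `(−Δ^η + M²)C = η^{−d}δ` on `ℤ^d`, every `λ` supported in a finite `S` and every bond
`b = (x, μ)`, `−wt1 + wt2 − wt3 − wt4 = 0` with the `b′`-sums over the window `dSupp S`. [cite: Balaban1983Higgs3, (2.26) p.431] -/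
theorem bracketFin_eq_zero (hη : η ≠ 0) (hCeven : ∀ z, Cf (-z) = Cf z)
    (hCeq : ∀ z, negLapZ η Cf z + M2 * Cf z = if z = 0 then η⁻¹ ^ d else 0) (hS : ∀ z ∉ S, lam z = 0) (x : ZSite d)
    (μ : Fin d) : bracketFin (dSupp S) η Cf lam x μ = 0 := by
  have hS' : ∀ z, z ∉ S → lam z = 0 := hS
  have hsub' : ∀ ν : Fin d, ∀ s ∈ S, s - unitVec ν ∈ dSupp S := fun ν s hs => sub_unitVec_mem_dSupp hs ν
  have h1 := current_insertion_eq hη hCeq hS' (subset_dSupp S) hsub' x (x + unitVec μ)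
  have h2 := current_insertion_eq hη hCeq hS' (subset_dSupp S) hsub' x x
  rw [bracketFin, neg_wt1Fin_add_wt2Fin_eq, h1, h2]
  simp only [wt3, wt4, kerCDZ, pdiffZ, sub_self, show x - (x + unitVec μ) = -unitVec μ by abel, hCeven, inv_pow]
  field_simp
  ring

/-- hence the free bracket `bracket226` of `B3WT226FreeLattice` (infinite `b′`-sums) vanishes for every finitely supported test
function, every `η ≠ 0` and every even solution of the lattice equation — (2.26) at free boundary conditions, per bond, by the
kernel Ward identity. [cite: Balaban1983Higgs3, (2.26) p.431] -/
theorem bracket226_eq_zero_of_current_insertion (hη : η ≠ 0) (hCeven : ∀ z, Cf (-z) = Cf z)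
    (hCeq : ∀ z, negLapZ η Cf z + M2 * Cf z = if z = 0 then η⁻¹ ^ d else 0) (hS : ∀ z ∉ S, lam z = 0) (x : ZSite d)
    (μ : Fin d) : bracket226 η Cf lam x μ = 0 := by
  rw [bracket226_eq_bracketFin hS, bracketFin_eq_zero hη hCeven hCeq hS]

/-- instance: the free massive propagator `C^η_{M²}` (`η > 0`, `M² > 0`). [cite: Balaban1983Higgs3, (2.26) p.431] -/
theorem bracket226_CetaM_eq_zero (hη : 0 < η) (hM : 0 < M2) (hS : ∀ z ∉ S, lam z = 0) (x : ZSite d) (μ : Fin d) :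
    bracket226 η (CetaM d η M2) lam x μ = 0 :=
  bracket226_eq_zero_of_current_insertion hη.ne' CetaM_neg (negLapZ_CetaM_add hη hM) hS x μ

end Literature.MathematicalPhysics.QuantumFieldTheory.Balaban1983to89.B3WTKernelWardIdentity

end
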